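import Literature.Geometry.DiscreteGeometry.ThreePointKernelGeneral
import HarnessLib

/-!
# The Bachoc–Vallentin three-point kernels `Q 4 k` (codes on `S³ ⊂ ℝ⁴`) for `k ≤ 6`, written out

Framing: lottery ticket; floor = certified bounds/negative ranges. Venture `PackingBounds`, cell
`pub-packcert`, energy family E3PT (pub-packcert-energy gen 13; the `n = 4` kernel route).

For `n = 4` the Gegenbauer parameter of the tree's kernel
`BachocVallentin.Q n k u v t = P_k^{((n-3)/2)}(2(t - uv), (1-u²)(1-v²))` (bivariate homogenised form) is `1/2`:
homogenised Legendre polynomials. With `x = t - uv` and `w = (1-u²)(1-v²)`: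
`Q 4 0 = 1`, `Q 4 1 = x`, `Q 4 2 = (3x² - w)/2`, `Q 4 3 = (5x³ - 3xw)/2`, `Q 4 4 = (35x⁴ - 30x²w + 3w²)/8`,
`Q 4 5 = (63x⁵ - 70x³w + 15xw²)/8`, `Q 4 6 = (231x⁶ - 315x⁴w + 105x²w² - 5w³)/16` — from `gegenbauerHom_zero`,
`gegenbauerHom_one` and the three-term recurrence `gegenbauerHom_rec`, each step a `linear_combination` of the
recurrence instance and the two previous values. These closed forms let the exact three-point energy certificates for
ten points on `S³` (the `(4,10)` Petersen code / pentagon configurations) expand the factored three-point function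
`threePointF 4 K R d g` of `ThreePointBoundGeneral` by `ring`.
-/

noncomputable section

namespace Summit.Ventures.PackingBounds.Energy.QFour

open Literature.Geometry.DiscreteGeometry.BachocVallentin Literature.Analysis.SpecialFunctions

/-- `Q 4 0 = 1`. -/
theorem Q4_zero (u v t : ℝ) : Q 4 0 u v t = 1 := Q_zero 4 u v t

/-- `Q 4 1 = t - uv` (`P_1 = λσ` with `λ = 1/2`, `σ = 2(t - uv)`). -/
theorem Q4_one (u v t : ℝ) : Q 4 1 u v t = t - u * v := by
  rw [Q, gegenbauerHom_one, smul_eq_mul]; push_cast; ring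

/-- `Q 4 2 = (3(t-uv)² - (1-u²)(1-v²))/2`. -/
theorem Q4_two (u v t : ℝ) :
    Q 4 2 u v t = (3 * (t - u * v) ^ 2 - (1 - u ^ 2) * (1 - v ^ 2)) / 2 := by
  have hq0 := Q4_zero u v t
  have hq1 := Q4_one u v t
  have h := gegenbauerHom_rec ((((4 : ℕ) : ℝ) - 3) / 2) (2 * (t - u * v)) ((1 - u ^ 2) * (1 - v ^ 2)) 0
  unfold Q at hq0 hq1 ⊢
  simp only [smul_eq_mul, Nat.cast_zero, Nat.reduceAdd] at h
  push_cast at h hq0 hq1 ⊢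
  linear_combination (1 / 2 : ℝ) * h + (3 / 2 : ℝ) * (t - u * v) * hq1
    - (1 / 2 : ℝ) * ((1 - u ^ 2) * (1 - v ^ 2)) * hq0

/-- `Q 4 3 = (5(t-uv)³ - 3(t-uv)(1-u²)(1-v²))/2`. -/
theorem Q4_three (u v t : ℝ) :
    Q 4 3 u v t = (5 * (t - u * v) ^ 3 - 3 * (t - u * v) * ((1 - u ^ 2) * (1 - v ^ 2))) / 2 := by
  have hq0 := Q4_one u v t
  have hq1 := Q4_two u v t
  have h := gegenbauerHom_rec ((((4 : ℕ) : ℝ) - 3) / 2) (2 * (t - u * v)) ((1 - u ^ 2) * (1 - v ^ 2)) 1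
  unfold Q at hq0 hq1 ⊢
  simp only [smul_eq_mul, Nat.cast_one, Nat.reduceAdd] at h
  push_cast at h hq0 hq1 ⊢
  linear_combination (1 / 3 : ℝ) * h + (5 / 3 : ℝ) * (t - u * v) * hq1
    - (2 / 3 : ℝ) * ((1 - u ^ 2) * (1 - v ^ 2)) * hq0

/-- `Q 4 4 = (35x⁴ - 30x²w + 3w²)/8`, `x = t - uv`, `w = (1-u²)(1-v²)`. -/
theorem Q4_four (u v t : ℝ) :
    Q 4 4 u v t = (35 * (t - u * v) ^ 4 - 30 * (t - u * v) ^ 2 * ((1 - u ^ 2) * (1 - v ^ 2))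
      + 3 * ((1 - u ^ 2) * (1 - v ^ 2)) ^ 2) / 8 := by
  have hq0 := Q4_two u v t
  have hq1 := Q4_three u v t
  have h := gegenbauerHom_rec ((((4 : ℕ) : ℝ) - 3) / 2) (2 * (t - u * v)) ((1 - u ^ 2) * (1 - v ^ 2)) 2
  unfold Q at hq0 hq1 ⊢
  simp only [smul_eq_mul, Nat.cast_ofNat, Nat.reduceAdd] at h
  push_cast at h hq0 hq1 ⊢
  linear_combination (1 / 4 : ℝ) * h + (7 / 4 : ℝ) * (t - u * v) * hq1
    - (3 / 4 : ℝ) * ((1 - u ^ 2) * (1 - v ^ 2)) * hq0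

/-- `Q 4 5 = (63x⁵ - 70x³w + 15xw²)/8`, `x = t - uv`, `w = (1-u²)(1-v²)`. -/
theorem Q4_five (u v t : ℝ) :
    Q 4 5 u v t = (63 * (t - u * v) ^ 5 - 70 * (t - u * v) ^ 3 * ((1 - u ^ 2) * (1 - v ^ 2))
      + 15 * (t - u * v) * ((1 - u ^ 2) * (1 - v ^ 2)) ^ 2) / 8 := by
  have hq0 := Q4_three u v t
  have hq1 := Q4_four u v t
  have h := gegenbauerHom_rec ((((4 : ℕ) : ℝ) - 3) / 2) (2 * (t - u * v)) ((1 - u ^ 2) * (1 - v ^ 2)) 3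
  unfold Q at hq0 hq1 ⊢
  simp only [smul_eq_mul, Nat.cast_ofNat, Nat.reduceAdd] at h
  push_cast at h hq0 hq1 ⊢
  linear_combination (1 / 5 : ℝ) * h + (9 / 5 : ℝ) * (t - u * v) * hq1
    - (4 / 5 : ℝ) * ((1 - u ^ 2) * (1 - v ^ 2)) * hq0

/-- `Q 4 6 = (231x⁶ - 315x⁴w + 105x²w² - 5w³)/16`, `x = t - uv`, `w = (1-u²)(1-v²)`. -/
theorem Q4_six (u v t : ℝ) :
    Q 4 6 u v t = (231 * (t - u * v) ^ 6 - 315 * (t - u * v) ^ 4 * ((1 - u ^ 2) * (1 - v ^ 2))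
      + 105 * (t - u * v) ^ 2 * ((1 - u ^ 2) * (1 - v ^ 2)) ^ 2 - 5 * ((1 - u ^ 2) * (1 - v ^ 2)) ^ 3) / 16 := by
  have hq0 := Q4_four u v t
  have hq1 := Q4_five u v t
  have h := gegenbauerHom_rec ((((4 : ℕ) : ℝ) - 3) / 2) (2 * (t - u * v)) ((1 - u ^ 2) * (1 - v ^ 2)) 4
  unfold Q at hq0 hq1 ⊢
  simp only [smul_eq_mul, Nat.cast_ofNat, Nat.reduceAdd] at h
  push_cast at h hq0 hq1 ⊢
  linear_combination (1 / 6 : ℝ) * h + (11 / 6 : ℝ) * (t - u * v) * hq1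
    - (5 / 6 : ℝ) * ((1 - u ^ 2) * (1 - v ^ 2)) * hq0

/-- At a pole pair (`u = v`, `t = 1`): `Q 4 k u u 1 = (1 - u²)^k` for `k ≤ 6` — the Legendre normalisation `P_k(1) = 1`
(sanity check of the closed forms). -/
theorem Q4_pole (u : ℝ) :
    Q 4 2 u u 1 = (1 - u ^ 2) ^ 2 ∧ Q 4 3 u u 1 = (1 - u ^ 2) ^ 3 ∧ Q 4 4 u u 1 = (1 - u ^ 2) ^ 4
      ∧ Q 4 5 u u 1 = (1 - u ^ 2) ^ 5 ∧ Q 4 6 u u 1 = (1 - u ^ 2) ^ 6 := by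
  refine ⟨?_, ?_, ?_, ?_, ?_⟩
  · rw [Q4_two]; ring
  · rw [Q4_three]; ring
  · rw [Q4_four]; ring
  · rw [Q4_five]; ring
  · rw [Q4_six]; ring

end Summit.Ventures.PackingBounds.Energy.QFour
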